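import Literature.AlgebraicGeometry.ComplexMultiplication.CyclotomicFermatCMTypesThreePowerLevelCoincidences
import HarnessLib

/-!
# Koblitz–Rohrlich §1: the level of a triple — `H_{(dr, ds, dt)}` modulo `dM` is the pull-back of `H_{(r, s, t)}` modulo `M`

Layer `Literature/AlgebraicGeometry/ComplexMultiplication`, namespace `…ComplexMultiplication.CyclotomicFermatCMType`; a small structural
companion of the `CyclotomicFermatCMTypes*` series (the tree's `fermatCMType N r s t = H_{r,s,t} = {h ∈ (ℤ/N)ˣ : ⟨hr⟩ + ⟨hs⟩ + ⟨ht⟩ = N}`).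
THEOREMS ONLY (no definition, no named fact, no `sorry`); no kernel `decide`.

THE SOURCE.  N. Koblitz, D. Rohrlich, *Simple factors in the Jacobian of a Fermat curve*, Canad. J. Math. **30** (1978) 1183–1205, §1
(pp. 1183–1184): "Given a pair of integers `(r, s)` … let `M` be the integer defined by `N/M = g.c.d.(N, r, s)`. … let `H_{r,s}` be the subset
of `(ℤ/Mℤ)*` of all elements `h` such that `⟨hr⟩ + ⟨hs⟩ ≤ N − 1`.  Then `H_{r,s}` is a set of coset representatives for `{−1, 1}` in `(ℤ/Mℤ)*`
… we define `L_{r,s}` as the lattice in `ℂ^{φ(M)/2}` …" and (p. 1184) "`H_{r,s} = H_{r,s,t}` is the set of those `h` for which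
`⟨hr⟩ + ⟨hs⟩ + ⟨ht⟩ = N`"; §2 (p. 1187): "Without loss of generality, we may assume that g.c.d.`(N, r, s, t) = 1`, whence `M = N`";
the Remark on p. 1189: "`G` is an "odd distribution", i.e. … 1) `G(N/M · r)` …" — the compatibility of the residue sets with the change of
level `M ∣ N`.

WHAT IS PROVED (the tree's `fermatCMType` is always read at the full level `N`; this file supplies the change of level that K–R use
silently): for `N = d·M` (`d ≥ 1`) and natural numbers `a, b, c`, a residue `x` modulo `N` lies in `H_{(da, db, dc)} ⊂ (ℤ/N)ˣ` iff `x` is a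
unit and its reduction modulo `M` lies in `H_{(a, b, c)} ⊂ (ℤ/M)ˣ` (**`mem_fermatCMType_level_mul_iff`**, §2), because `⟨x·da⟩_N = d·⟨x̄·a⟩_M`
(§1).  Corollaries (§3): the description does not depend on the lift; Koblitz–Rohrlich's Theorem 3 pairs with `m ≥ 1` are the pull-backs of
the `m = 0` pair at level `3^{n−m}` (`mem_fermatCMType_threePow_iff_castHom_mem`); and "the same elliptic curve that occurs for `N = 7`":
at every level `7q`, `H_{(q, 2q, 4q)}` is the pull-back of `H_{(1,2,4)} ⊂ (ℤ/7)ˣ` (the sibling's `N = 21` instance by `decide`, here for all `q`).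

## Honest column / NOT here

* K–R phrase the change of level through lattices `L_{r,s} ⊂ ℂ^{φ(M)/2}` and the distribution `G`; typed is only the residue-set statement.
* The converse bookkeeping "every triple is `d` times a triple of level `M = N/gcd`" (existence of the primitive triple) is not spelled out.

## References

* [KoblitzRohrlich1978] N. Koblitz, D. Rohrlich, Canad. J. Math. 30 (1978) 1183–1205: §1 (pp. 1183–1185), §2 (p. 1187), Remark (p. 1189),
  Theorem 3 (p. 1186), Remark 2 (p. 1193).

## Provenance

Cell `pub-hodgecm2` (COR-CM), literature seat `lit-deligne-3` gen 36 (claim KR78-LEVEL-PULLBACK; count-neutral, own lane).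
-/

open NumberField

namespace Literature.AlgebraicGeometry.ComplexMultiplication

open Literature.AlgebraicGeometry.HodgeTheory

namespace CyclotomicFermatCMType

/-! ## §1 Residues under the change of level `M ∣ dM` -/

section Residues

variable {M d : ℕ}

/-- `⟨x·(da)⟩_{dM} = d·⟨x̄·a⟩_M`: the residue of `x·da` modulo `dM` is `d` times the residue of `(x mod M)·a` modulo `M`.
[cite: KoblitzRohrlich1978, §1 (pp. 1183–1184)] -/
theorem val_mul_natCast_mul_eq [NeZero M] [NeZero (d * M)] (x : ZMod (d * M)) (a : ℕ) :
    (x * ((d * a : ℕ) : ZMod (d * M))).val = d * (ZMod.castHom (dvd_mul_left M d) (ZMod M) x * (a : ZMod M)).val := by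
  have h1 : (x * ((d * a : ℕ) : ZMod (d * M))).val = d * (x.val * a % M) := by
    rw [ZMod.val_mul, ZMod.val_natCast, Nat.mul_mod x.val, Nat.mod_mod, ← Nat.mul_mod, mul_left_comm, Nat.mul_mod_mul_left]
  have h2 : (ZMod.castHom (dvd_mul_left M d) (ZMod M) x * (a : ZMod M)).val = x.val * a % M := by
    rw [ZMod.val_mul, ZMod.castHom_apply, ZMod.cast_eq_val, ZMod.val_natCast, ZMod.val_natCast, ← Nat.mul_mod]
  rw [h1, h2]

/-- The reduction of a unit modulo `dM` is a unit modulo `M` (on `val`: `gcd(x mod M, M) = gcd(x, M) = 1`). [folklore] -/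
private theorem val_castHom_coprime [NeZero M] [NeZero (d * M)] {x : ZMod (d * M)} (hx : x.val.Coprime (d * M)) :
    (ZMod.castHom (dvd_mul_left M d) (ZMod M) x).val.Coprime M := by
  rw [ZMod.castHom_apply, ZMod.cast_eq_val, ZMod.val_natCast]
  have hM : x.val.Coprime M := Nat.Coprime.coprime_mul_left_right hx
  unfold Nat.Coprime at hM ⊢
  rw [← Nat.gcd_rec, Nat.gcd_comm]
  exact hM

end Residues

/-! ## §2 `H_{(da, db, dc)}` modulo `dM` is the pull-back of `H_{(a, b, c)}` modulo `M` -/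

section Pullback

variable {M d : ℕ}

/-- **THE CHANGE OF LEVEL** ("let `M` be the integer defined by `N/M = g.c.d.(N, r, s)` … `H_{r,s}` … subset of `(ℤ/Mℤ)*`", §1): for
`N = dM`, `d ≥ 1`, and natural numbers `a, b, c`, a residue `x` modulo `N` lies in `H_{(da, db, dc)}` iff `x` is a unit modulo `N` and its
reduction modulo `M` lies in `H_{(a, b, c)}` — `⟨x·da⟩ + ⟨x·db⟩ + ⟨x·dc⟩ = dM` iff `⟨x̄a⟩ + ⟨x̄b⟩ + ⟨x̄c⟩ = M`.
[cite: KoblitzRohrlich1978, §1 (pp. 1183–1184) and §2 (p. 1187)] -/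
theorem mem_fermatCMType_level_mul_iff [NeZero M] [NeZero (d * M)] (hd : 0 < d) (a b c : ℕ) (x : ZMod (d * M)) :
    x ∈ fermatCMType (d * M) ((d * a : ℕ) : ZMod (d * M)) ((d * b : ℕ) : ZMod (d * M)) ((d * c : ℕ) : ZMod (d * M)) ↔
      x.val.Coprime (d * M) ∧
        ZMod.castHom (dvd_mul_left M d) (ZMod M) x ∈ fermatCMType M (a : ZMod M) (b : ZMod M) (c : ZMod M) := by
  simp only [fermatCMType, Finset.mem_filter, Finset.mem_univ, true_and, val_mul_natCast_mul_eq]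
  constructor
  · rintro ⟨hc, hs⟩
    refine ⟨hc, val_castHom_coprime hc, ?_⟩
    rw [← mul_add, ← mul_add] at hs
    exact Nat.eq_of_mul_eq_mul_left hd hs
  · rintro ⟨hc, -, hs⟩
    refine ⟨hc, ?_⟩
    rw [← mul_add, ← mul_add, hs]

/-- **Equality of pull-backs**: if `H_{(a,b,c)} = H_{(a′,b′,c′)}` modulo `M`, then `H_{(da,db,dc)} = H_{(da′,db′,dc′)}` modulo `dM` — equal
types at level `M` stay equal after the change of level ("`L_{r,s}` … identical lattices", §1 p. 1184). [cite: KoblitzRohrlich1978, §1 (p. 1184)] -/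
theorem fermatCMType_level_mul_eq_of_eq [NeZero M] [NeZero (d * M)] (hd : 0 < d) {a b c a' b' c' : ℕ}
    (h : fermatCMType M (a : ZMod M) (b : ZMod M) (c : ZMod M) = fermatCMType M (a' : ZMod M) (b' : ZMod M) (c' : ZMod M)) :
    fermatCMType (d * M) ((d * a : ℕ) : ZMod (d * M)) ((d * b : ℕ) : ZMod (d * M)) ((d * c : ℕ) : ZMod (d * M)) =
      fermatCMType (d * M) ((d * a' : ℕ) : ZMod (d * M)) ((d * b' : ℕ) : ZMod (d * M)) ((d * c' : ℕ) : ZMod (d * M)) := by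
  ext x
  rw [mem_fermatCMType_level_mul_iff hd, mem_fermatCMType_level_mul_iff hd, h]

end Pullback

/-! ## §3 Corollaries: Theorem 3's pairs with `m ≥ 1`; "the same elliptic curve that occurs for `N = 7`" at every level `7q` -/

section Corollaries

/-- **Theorem 3's pairs with `m ≥ 1` are pull-backs**: for `m + 2 ≤ n`, a residue `x` modulo `3ⁿ = 3ᵐ·3^{n−m}` lies in
`H_{(3ᵐ⁺¹, 3ⁿ⁻¹ − 2·3ᵐ, 2·3ⁿ⁻¹ − 3ᵐ)}` iff it is a unit and its reduction modulo `3^{n−m}` lies in the `m = 0` set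
`H_{(3, 3^{n−m−1} − 2, 2·3^{n−m−1} − 1)}` there (the entries written as `3ᵐ·(3, 3^{n−m−1} − 2, 2·3^{n−m−1} − 1)`; the rewriting to
K–R's `(3ᵐ⁺¹, 3ⁿ⁻¹ − 2·3ᵐ, 2·3ⁿ⁻¹ − 3ᵐ)` is `threePow_triple_eq_mul`). [cite: KoblitzRohrlich1978, Theorem 3 (p. 1186) and §1 (p. 1184)] -/
theorem mem_fermatCMType_threePow_iff_castHom_mem {n m : ℕ} [NeZero (3 ^ (n - m))] [NeZero (3 ^ m * 3 ^ (n - m))]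
    (x : ZMod (3 ^ m * 3 ^ (n - m))) :
    x ∈ fermatCMType (3 ^ m * 3 ^ (n - m)) ((3 ^ m * 3 : ℕ) : ZMod (3 ^ m * 3 ^ (n - m)))
        ((3 ^ m * (3 ^ (n - m - 1) - 2) : ℕ) : ZMod (3 ^ m * 3 ^ (n - m)))
        ((3 ^ m * (2 * 3 ^ (n - m - 1) - 1) : ℕ) : ZMod (3 ^ m * 3 ^ (n - m))) ↔
      x.val.Coprime (3 ^ m * 3 ^ (n - m)) ∧
        ZMod.castHom (dvd_mul_left (3 ^ (n - m)) (3 ^ m)) (ZMod (3 ^ (n - m))) x ∈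
          fermatCMType (3 ^ (n - m)) ((3 : ℕ) : ZMod (3 ^ (n - m))) ((3 ^ (n - m - 1) - 2 : ℕ) : ZMod (3 ^ (n - m)))
            ((2 * 3 ^ (n - m - 1) - 1 : ℕ) : ZMod (3 ^ (n - m))) :=
  mem_fermatCMType_level_mul_iff (pow_pos (by norm_num : 0 < 3) m) 3 _ _ x

/-- The arithmetic behind the previous corollary: `3ⁿ = 3ᵐ·3^{n−m}`, `3ᵐ⁺¹ = 3ᵐ·3`, `3ⁿ⁻¹ − 2·3ᵐ = 3ᵐ(3^{n−m−1} − 2)`,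
`2·3ⁿ⁻¹ − 3ᵐ = 3ᵐ(2·3^{n−m−1} − 1)` (`m + 2 ≤ n`) — Theorem 3's triples `(3ᵐ⁺¹, 3ⁿ⁻¹ − 2·3ᵐ, 2·3ⁿ⁻¹ − 3ᵐ)` as `3ᵐ`-multiples of the
level-`3^{n−m}` triple `(3, 3^{n−m−1} − 2, 2·3^{n−m−1} − 1)`. [cite: KoblitzRohrlich1978, Theorem 3 (p. 1186)] -/
theorem threePow_triple_eq_mul {n m : ℕ} (hmn : m + 2 ≤ n) :
    3 ^ n = 3 ^ m * 3 ^ (n - m) ∧ 3 ^ (m + 1) = 3 ^ m * 3 ∧ 3 ^ (n - 1) - 2 * 3 ^ m = 3 ^ m * (3 ^ (n - m - 1) - 2) ∧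
      2 * 3 ^ (n - 1) - 3 ^ m = 3 ^ m * (2 * 3 ^ (n - m - 1) - 1) := by
  have h1 : 3 ^ n = 3 ^ m * 3 ^ (n - m) := by
    rw [← pow_add]
    congr 1
    omega
  have h2 : 3 ^ (n - 1) = 3 ^ m * 3 ^ (n - m - 1) := by
    rw [← pow_add]
    congr 1
    omega
  refine ⟨h1, pow_succ 3 m, ?_, ?_⟩
  · rw [h2, Nat.mul_sub, mul_comm 2 (3 ^ m)]
  · rw [h2, Nat.mul_sub, mul_one, ← mul_assoc, mul_comm 2 (3 ^ m), mul_assoc]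

/-- **"the same elliptic curve that occurs for `N = 7` and the triple `(1, 2, 4)`", EVERY LEVEL `7q`**: a residue `x` modulo `7q` (`q ≥ 1`)
lies in `H_{(q, 2q, 4q)}` iff it is a unit and its reduction modulo `7` lies in `H_{(1,2,4)}` (the sibling's `N = 21` statement
`mem_fermatCMType_twentyOne_iff_mod_seven` by `decide`, here at every level). [cite: KoblitzRohrlich1978, §2 Remark 2 (p. 1193) and §1 (p. 1184)] -/
theorem mem_fermatCMType_seven_mul_iff {q : ℕ} [NeZero (q * 7)] (hq : 0 < q) (x : ZMod (q * 7)) :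
    x ∈ fermatCMType (q * 7) ((q * 1 : ℕ) : ZMod (q * 7)) ((q * 2 : ℕ) : ZMod (q * 7)) ((q * 4 : ℕ) : ZMod (q * 7)) ↔
      x.val.Coprime (q * 7) ∧ ZMod.castHom (dvd_mul_left 7 q) (ZMod 7) x ∈ fermatCMType 7 1 2 4 := by
  have h := mem_fermatCMType_level_mul_iff (M := 7) hq 1 2 4 x
  simp only [Nat.cast_one, Nat.cast_ofNat] at h
  exact h

end Corollaries

end CyclotomicFermatCMType

end Literature.AlgebraicGeometry.ComplexMultiplication
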